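import Literature.Analysis.Complex.RectangleResidueSimplePoles
import Literature.NumberTheory.BeurlingPrimes.DMVLineShift
import Literature.NumberTheory.LFunctions.RieszMeanPerron
import Literature.NumberTheory.LFunctions.XiKernelLaplace
import Mathlib.Analysis.SpecialFunctions.Integrals.Basic
import Mathlib.MeasureTheory.Measure.Lebesgue.Integral
import HarnessLib

/-!
# Perron inversion of order one: shifting the contour across finitely many real simple poles

Topic `Literature/NumberTheory/BeurlingPrimes`. Everything in this file is PROVED.

This is the analytic engine of the Perron inversion "in the spirit of Diamond–Zhang" used by
Broucke–Vindas (2024, proof of Theorem 3.1) and Broucke–Debruyne–Révész (2023, proof of Theorem 3.2,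
(3.5)–(3.8), and §4): with the **order-one Perron kernel**

  `K(y₁, y₂; s) = (y₂^{1+s} − y₁^{1+s})/(s(s+1))`   (`perronKernel`),

for which `N₁(y₂) − N₁(y₁) = (1/2π) ∫ K(y₁,y₂;κ+it) ζ_𝒫(κ+it) dt` (`BeurlingPerronFormula.lean`), one writes the
continued zeta function on a strip `σ₀ < Re s` as `G(s) = Σ_{p ∈ S} r_p/(s − p) + H(s)` with finitely many
REAL simple poles `p ∈ (σ₁, κ)` and `H` holomorphic, and

* `perron_integral_eq_residues_add` — **moves the line of integration** from `Re s = κ` to `Re s = σ₁`: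
  `∫ K G (κ+it) dt = 2π Σ_p r_p K(y₁,y₂;p) + ∫ K G (σ₁+it) dt`, by the residue theorem on the rectangles
  `[σ₁, κ] × [−T, T]` (tree: `Literature.Analysis.Complex.rectBoundaryIntegral_eq_sum_of_simplePoles`) and
  `T → ∞`, the horizontal sides being killed by a bound `‖G(u + iT)‖ ≤ B(|T|)` with `B(T)/T² → 0`
  (BDR: "We transfer the integration contour … which is justified in view of the bound (3.4). By the residue
  theorem we get …");
* `perron_vertical_norm_le` — **estimates the shifted integral**: if `‖G(σ+it)‖ ≤ B(|t|)` with `B ≥ 0`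
  monotone, then for every `X > 0`
  `∫ ‖K G (σ+it)‖ dt ≤ 4 y₂^σ ∫₀^X B(t)/(σ+t) dt + 4 y₂^{1+σ} ∫_X^∞ B(t)/t² dt`
  (BDR/BV: "we split the range of integration into two pieces: `|t| ≤ x` and `|t| > x`. In the first piece we
  bound `(x+1)^{s+1} − x^{s+1}` by `|s+1|x^{σ}`, whereas in the second one by `x^{σ+1}`"), using the kernel
  bounds `‖K(s)‖ ≤ (y₂ − y₁) y₂^σ/‖s‖` (`norm_perronKernel_le_div`) and `‖K(s)‖ ≤ 2y₂^{1+σ}/‖s(s+1)‖`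
  (`norm_perronKernel_le_two_mul`).

The statements are pure complex analysis (no Beurling system appears); the application to `N_𝒫` is in the
files using them.

## References
* [BrouckeDebruyneRevesz2023] F. Broucke, G. Debruyne, Sz. Gy. Révész, *Some examples of well-behaved Beurling
  number systems*, arXiv:2309.01567, proof of Theorem 3.2 ((3.5)–(3.8) and the estimates following them) and §4
  (read).
* [BrouckeVindas2024] F. Broucke, J. Vindas, Math. Z. 307 (2024), arXiv:2102.08478, proof of Theorem 3.1 (read).
* [Conway1978] J. B. Conway, *Functions of One Complex Variable I*, GTM 11, Ch. V Thm. 2.2 (residue theorem).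
-/

noncomputable section

open Complex Filter Set MeasureTheory Real intervalIntegral
open scoped Topology

namespace Literature.NumberTheory.BeurlingPrimes

open Literature.Analysis.Complex Literature.NumberTheory.LFunctions

/-! ### The kernel -/

/-- The **order-one Perron kernel** `K(y₁, y₂; s) = (y₂^{1+s} − y₁^{1+s})/(s(s+1))`
(BDR 2023, (3.5): the kernel of `∫_x^{x+1} N_𝒫(u) du = (1/2πi)∫ ((x+1)^{s+1} − x^{s+1}) ζ_𝒫(s) ds/(s(s+1))`).
[cite: BrouckeDebruyneRevesz2023, (3.5)–(3.6)] -/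
def perronKernel (y₁ y₂ : ℝ) (s : ℂ) : ℂ :=
  ((y₂ : ℂ) ^ (1 + s) - (y₁ : ℂ) ^ (1 + s)) / (s * (s + 1))

/-- The pole part `Σ_{p ∈ S} r_p/(s − p)` of a function with finitely many real simple poles. [folklore] -/
def polePart (S : Finset ℝ) (r : ℝ → ℂ) (s : ℂ) : ℂ :=
  ∑ p ∈ S, r p / (s - p)

/-- `(σ + |t|)/2 ≤ ‖σ + it‖` for `σ ≥ 0`. [folklore] -/
theorem half_add_abs_le_norm {σ : ℝ} (hσ : 0 ≤ σ) (t : ℝ) : (σ + |t|) / 2 ≤ ‖(σ : ℂ) + t * I‖ := by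
  have h1 : |((σ : ℂ) + t * I).re| ≤ ‖(σ : ℂ) + t * I‖ := abs_re_le_norm _
  have h2 : |((σ : ℂ) + t * I).im| ≤ ‖(σ : ℂ) + t * I‖ := abs_im_le_norm _
  simp only [add_re, ofReal_re, mul_re, ofReal_im, I_re, mul_zero, I_im, mul_one, sub_self, add_zero,
    add_im, mul_im, zero_add, abs_of_nonneg hσ] at h1 h2
  linarith

/-- `t² ≤ ‖s(s+1)‖` on `Re s = σ ≥ 0`. [folklore] -/
theorem sq_le_norm_kernelDen {σ : ℝ} (hσ : 0 ≤ σ) (t : ℝ) :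
    t ^ 2 ≤ ‖((σ : ℂ) + t * I) * ((σ : ℂ) + t * I + 1)‖ :=
  le_trans (by nlinarith) (sq_add_sq_le_norm_kernelDen hσ t)

/-- `‖y₂^{1+s} − y₁^{1+s}‖ ≤ ‖s+1‖ (y₂ − y₁) y₂^σ` for `0 < y₁ ≤ y₂`, `σ = Re s ≥ 0`
(`y₂^{1+s} − y₁^{1+s} = (s+1)∫_{y₁}^{y₂} u^s du`). [cite: BrouckeDebruyneRevesz2023, proof of Theorem 3.2] -/
theorem norm_cpow_sub_cpow_le {y₁ y₂ : ℝ} (hy₁ : 0 < y₁) (hy₁₂ : y₁ ≤ y₂) {s : ℂ} (hs : 0 ≤ s.re) :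
    ‖(y₂ : ℂ) ^ (1 + s) - (y₁ : ℂ) ^ (1 + s)‖ ≤ ‖s + 1‖ * ((y₂ - y₁) * y₂ ^ s.re) := by
  have hint := integral_cpow (a := y₁) (b := y₂) (r := s) (Or.inl (by linarith))
  have hs1 : s + 1 ≠ 0 := by
    intro h; have := congrArg Complex.re h; simp at this; linarith
  have heq : (y₂ : ℂ) ^ (1 + s) - (y₁ : ℂ) ^ (1 + s) = (s + 1) * ∫ x : ℝ in y₁..y₂, (x : ℂ) ^ s := by
    rw [hint, add_comm 1 s]
    field_simp
  rw [heq, norm_mul]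
  refine mul_le_mul_of_nonneg_left ?_ (norm_nonneg _)
  have hb : ∀ x ∈ Set.uIoc y₁ y₂, ‖(x : ℂ) ^ s‖ ≤ y₂ ^ s.re := by
    intro x hx
    rw [uIoc_of_le hy₁₂] at hx
    have hx0 : 0 < x := lt_trans hy₁ hx.1
    rw [norm_cpow_eq_rpow_re_of_pos hx0]
    exact Real.rpow_le_rpow hx0.le hx.2 hs
  have := intervalIntegral.norm_integral_le_of_norm_le_const hb
  rwa [abs_of_nonneg (by linarith : (0 : ℝ) ≤ y₂ - y₁), mul_comm] at this

/-- `‖y₂^{1+s} − y₁^{1+s}‖ ≤ 2 y₂^{1+σ}` for `0 < y₁ ≤ y₂`, `1 + σ ≥ 0` (`σ = Re s`).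
[cite: BrouckeDebruyneRevesz2023, proof of Theorem 3.2] -/
theorem norm_cpow_sub_cpow_le_two {y₁ y₂ : ℝ} (hy₁ : 0 < y₁) (hy₁₂ : y₁ ≤ y₂) {s : ℂ} (hs : 0 ≤ 1 + s.re) :
    ‖(y₂ : ℂ) ^ (1 + s) - (y₁ : ℂ) ^ (1 + s)‖ ≤ 2 * y₂ ^ (1 + s.re) := by
  have hy₂ : 0 < y₂ := lt_of_lt_of_le hy₁ hy₁₂
  have h2 : ‖(y₂ : ℂ) ^ (1 + s)‖ = y₂ ^ (1 + s.re) := by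
    rw [norm_cpow_eq_rpow_re_of_pos hy₂]; simp
  have h1 : ‖(y₁ : ℂ) ^ (1 + s)‖ ≤ y₂ ^ (1 + s.re) := by
    rw [norm_cpow_eq_rpow_re_of_pos hy₁]
    simpa using Real.rpow_le_rpow hy₁.le hy₁₂ hs
  calc ‖(y₂ : ℂ) ^ (1 + s) - (y₁ : ℂ) ^ (1 + s)‖ ≤ ‖(y₂ : ℂ) ^ (1 + s)‖ + ‖(y₁ : ℂ) ^ (1 + s)‖ :=
        norm_sub_le _ _
    _ ≤ y₂ ^ (1 + s.re) + y₂ ^ (1 + s.re) := by rw [h2]; exact add_le_add le_rfl h1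
    _ = 2 * y₂ ^ (1 + s.re) := by ring

/-- **Kernel bound for `|t| ≤ x`:** `‖K(y₁,y₂; σ+it)‖ ≤ (y₂ − y₁) y₂^σ/‖σ+it‖` (`σ > 0`, `0 < y₁ ≤ y₂`).
[cite: BrouckeDebruyneRevesz2023, proof of Theorem 3.2] -/
theorem norm_perronKernel_le_div {y₁ y₂ σ : ℝ} (hy₁ : 0 < y₁) (hy₁₂ : y₁ ≤ y₂) (hσ : 0 < σ) (t : ℝ) :
    ‖perronKernel y₁ y₂ ((σ : ℂ) + t * I)‖ ≤ (y₂ - y₁) * y₂ ^ σ / ‖(σ : ℂ) + t * I‖ := by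
  set s : ℂ := (σ : ℂ) + t * I with hs
  have hsre : s.re = σ := by simp [hs]
  have hs0 : s ≠ 0 := by intro h; have := congrArg Complex.re h; simp [hs] at this; linarith
  have hs1 : s + 1 ≠ 0 := by intro h; have := congrArg Complex.re h; simp [hs] at this; linarith
  have hns : 0 < ‖s‖ := norm_pos_iff.2 hs0
  have hns1 : 0 < ‖s + 1‖ := norm_pos_iff.2 hs1
  unfold perronKernel
  rw [norm_div, norm_mul, div_le_div_iff₀ (mul_pos hns hns1) hns]
  have h := norm_cpow_sub_cpow_le hy₁ hy₁₂ (s := s) (by rw [hsre]; exact hσ.le)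
  rw [hsre] at h
  calc ‖(y₂ : ℂ) ^ (1 + s) - (y₁ : ℂ) ^ (1 + s)‖ * ‖s‖ ≤ ‖s + 1‖ * ((y₂ - y₁) * y₂ ^ σ) * ‖s‖ :=
        mul_le_mul_of_nonneg_right h hns.le
    _ = (y₂ - y₁) * y₂ ^ σ * (‖s‖ * ‖s + 1‖) := by ring

/-- **Kernel bound for `|t| > x`:** `‖K(y₁,y₂; σ+it)‖ ≤ 2 y₂^{1+σ}/‖s(s+1)‖ ≤ 2 y₂^{1+σ}/t²` (`σ > 0`,
`0 < y₁ ≤ y₂`). [cite: BrouckeDebruyneRevesz2023, proof of Theorem 3.2] -/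
theorem norm_perronKernel_le_two_mul {y₁ y₂ σ : ℝ} (hy₁ : 0 < y₁) (hy₁₂ : y₁ ≤ y₂) (hσ : 0 < σ) (t : ℝ) :
    ‖perronKernel y₁ y₂ ((σ : ℂ) + t * I)‖ ≤
      2 * y₂ ^ (1 + σ) / ‖((σ : ℂ) + t * I) * ((σ : ℂ) + t * I + 1)‖ := by
  unfold perronKernel
  rw [norm_div]
  refine div_le_div_of_nonneg_right ?_ (norm_nonneg _)
  have h := norm_cpow_sub_cpow_le_two hy₁ hy₁₂ (s := (σ : ℂ) + t * I) (by simp; linarith)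
  simpa using h

/-- The kernel is complex differentiable away from `s = 0, −1`, in particular on `Re s > σ₀ ≥ 0`
(for `y₁, y₂ > 0`). [folklore] -/
theorem differentiableAt_perronKernel {y₁ y₂ : ℝ} (hy₁ : 0 < y₁) (hy₂ : 0 < y₂) {s : ℂ} (hs : 0 < s.re) :
    DifferentiableAt ℂ (perronKernel y₁ y₂) s := by
  have hs0 : s ≠ 0 := by intro h; rw [h] at hs; simp at hs
  have hs1 : s + 1 ≠ 0 := by intro h; have := congrArg Complex.re h; simp at this; linarith
  unfold perronKernel
  refine DifferentiableAt.div ?_ (differentiableAt_id.mul (differentiableAt_id.add_const 1))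
    (mul_ne_zero hs0 hs1)
  refine DifferentiableAt.sub ?_ ?_
  · exact DifferentiableAt.const_cpow ((differentiableAt_const _).add differentiableAt_id)
      (Or.inl (ofReal_ne_zero.2 hy₂.ne'))
  · exact DifferentiableAt.const_cpow ((differentiableAt_const _).add differentiableAt_id)
      (Or.inl (ofReal_ne_zero.2 hy₁.ne'))

/-- `t ↦ K(y₁,y₂; σ+it)` is continuous for `σ > 0`. [folklore] -/
theorem continuous_perronKernel_vertical {y₁ y₂ σ : ℝ} (hy₁ : 0 < y₁) (hy₂ : 0 < y₂) (hσ : 0 < σ) :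
    Continuous fun t : ℝ ↦ perronKernel y₁ y₂ ((σ : ℂ) + t * I) := by
  refine continuous_iff_continuousAt.2 fun t ↦ ?_
  exact (differentiableAt_perronKernel hy₁ hy₂ (s := (σ : ℂ) + t * I) (by simpa using hσ)).continuousAt.comp
    (f := fun t : ℝ ↦ (σ : ℂ) + t * I) (by fun_prop)

/-! ### The estimate on a vertical line -/

/-- **The shifted Perron integral, estimated** (BDR 2023, end of the proof of Theorem 3.2; BV 2024, proof of
Theorem 3.1: "We split the range of integration into two pieces: `|t| ≤ x` and `|t| > x`. In the first piece we
bound `(x+1)^{s+1} − x^{s+1}` by `|s+1|x^{σ_x}`, whereas in the second one by `x^{σ_x+1}`"). Let `σ > 0`,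
`0 < y₁ ≤ y₂ ≤ y₁ + 1`, and let `G` be measurable on the line `Re s = σ` with `‖G(σ+it)‖ ≤ B(|t|)` for a
non-negative non-decreasing `B` with `∫_X^∞ B(t) t^{−2} dt < ∞` (`X > 0`). Then `t ↦ K(y₁,y₂;σ+it) G(σ+it)` is
integrable and `∫ ‖K G(σ+it)‖ dt ≤ 4 y₂^σ ∫₀^X B(t)/(σ+t) dt + 4 y₂^{1+σ} ∫_X^∞ B(t)/t² dt`.
[cite: BrouckeDebruyneRevesz2023, proof of Theorem 3.2] -/
theorem perron_vertical_norm_le {G : ℂ → ℂ} {B : ℝ → ℝ} {σ y₁ y₂ X : ℝ} (hσ : 0 < σ) (hy₁ : 0 < y₁)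
    (hy₁₂ : y₁ ≤ y₂) (hy₂ : y₂ ≤ y₁ + 1) (hX : 0 < X)
    (hGm : AEStronglyMeasurable (fun t : ℝ ↦ G ((σ : ℂ) + t * I)) volume)
    (hGB : ∀ t : ℝ, ‖G ((σ : ℂ) + t * I)‖ ≤ B |t|) (hB0 : 0 ≤ B 0) (hBm : Monotone B)
    (hBi : IntegrableOn (fun t ↦ B t / t ^ 2) (Ioi X)) :
    Integrable (fun t : ℝ ↦ perronKernel y₁ y₂ ((σ : ℂ) + t * I) * G ((σ : ℂ) + t * I)) ∧
      ∫ t : ℝ, ‖perronKernel y₁ y₂ ((σ : ℂ) + t * I) * G ((σ : ℂ) + t * I)‖ ≤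
        4 * y₂ ^ σ * (∫ t in Ioc 0 X, B t / (σ + t)) + 4 * y₂ ^ (1 + σ) * ∫ t in Ioi X, B t / t ^ 2 := by
  have hy₂0 : 0 < y₂ := lt_of_lt_of_le hy₁ hy₁₂
  have hBnn : ∀ t, 0 ≤ t → 0 ≤ B t := fun t ht ↦ hB0.trans (hBm ht)
  -- the majorant `h |t|`
  set h : ℝ → ℝ := fun u ↦ if u ≤ X then 2 * y₂ ^ σ * (B u / (σ + u)) else 2 * y₂ ^ (1 + σ) * (B u / u ^ 2)
    with hh
  set f : ℝ → ℂ := fun t ↦ perronKernel y₁ y₂ ((σ : ℂ) + t * I) * G ((σ : ℂ) + t * I) with hf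
  -- pointwise bound `‖f t‖ ≤ h |t|`
  have hpt : ∀ t : ℝ, ‖f t‖ ≤ h |t| := by
    intro t
    have hst : 0 < σ + |t| := by positivity
    simp only [hf, hh, norm_mul]
    by_cases ht : |t| ≤ X
    · rw [if_pos ht]
      have hK := norm_perronKernel_le_div hy₁ hy₁₂ hσ t
      have hn := half_add_abs_le_norm hσ.le t
      have hnpos : 0 < ‖(σ : ℂ) + t * I‖ := lt_of_lt_of_le (by positivity) hn
      have hK' : ‖perronKernel y₁ y₂ ((σ : ℂ) + t * I)‖ ≤ 2 * y₂ ^ σ / (σ + |t|) := by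
        refine hK.trans ?_
        rw [div_le_div_iff₀ hnpos hst]
        have hyy : (y₂ - y₁) * y₂ ^ σ ≤ y₂ ^ σ := by
          have : 0 ≤ y₂ ^ σ := by positivity
          nlinarith
        calc (y₂ - y₁) * y₂ ^ σ * (σ + |t|) ≤ y₂ ^ σ * (σ + |t|) :=
              mul_le_mul_of_nonneg_right hyy hst.le
          _ ≤ y₂ ^ σ * (2 * ‖(σ : ℂ) + t * I‖) := mul_le_mul_of_nonneg_left (by linarith) (by positivity)
          _ = 2 * y₂ ^ σ * ‖(σ : ℂ) + t * I‖ := by ring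
      calc ‖perronKernel y₁ y₂ ((σ : ℂ) + t * I)‖ * ‖G ((σ : ℂ) + t * I)‖
          ≤ 2 * y₂ ^ σ / (σ + |t|) * B |t| :=
            mul_le_mul hK' (hGB t) (norm_nonneg _) (by positivity)
        _ = 2 * y₂ ^ σ * (B |t| / (σ + |t|)) := by ring
    · rw [if_neg ht]
      push Not at ht
      have ht0 : 0 < |t| := hX.trans ht
      have htne : t ≠ 0 := abs_pos.1 ht0
      have hK := norm_perronKernel_le_two_mul hy₁ hy₁₂ hσ t
      have hden := sq_le_norm_kernelDen hσ.le t
      have ht2 : 0 < t ^ 2 := by positivity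
      have hK' : ‖perronKernel y₁ y₂ ((σ : ℂ) + t * I)‖ ≤ 2 * y₂ ^ (1 + σ) / t ^ 2 :=
        hK.trans (div_le_div_of_nonneg_left (by positivity) ht2 hden)
      calc ‖perronKernel y₁ y₂ ((σ : ℂ) + t * I)‖ * ‖G ((σ : ℂ) + t * I)‖
          ≤ 2 * y₂ ^ (1 + σ) / t ^ 2 * B |t| :=
            mul_le_mul hK' (hGB t) (norm_nonneg _) (by positivity)
        _ = 2 * y₂ ^ (1 + σ) * (B |t| / |t| ^ 2) := by rw [sq_abs]; ring
  -- integrability of the majorant on `(0, ∞)`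
  have hBmeas : Measurable B := hBm.measurable
  have hh1 : IntegrableOn h (Ioc 0 X) := by
    have hb : ∀ u ∈ Ioc 0 X, ‖h u‖ ≤ 2 * y₂ ^ σ * (B X / σ) := by
      intro u hu
      have hu0 : 0 < u := hu.1
      have hBu : 0 ≤ B u := hBnn u hu0.le
      simp only [hh, if_pos hu.2]
      rw [Real.norm_eq_abs, abs_of_nonneg (by positivity)]
      refine mul_le_mul_of_nonneg_left ?_ (by positivity)
      have hsu : σ ≤ σ + u := by linarith
      calc B u / (σ + u) ≤ B X / (σ + u) := div_le_div_of_nonneg_right (hBm hu.2) (by linarith)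
        _ ≤ B X / σ := div_le_div_of_nonneg_left (hBnn X hX.le) hσ hsu
    have hmeas : AEStronglyMeasurable h volume := by
      refine Measurable.aestronglyMeasurable ?_
      simp only [hh]
      refine Measurable.ite measurableSet_Iic ?_ ?_
      · exact (hBmeas.div (measurable_const.add measurable_id)).const_mul _
      · exact (hBmeas.div (measurable_id.pow_const 2)).const_mul _
    refine Measure.integrableOn_of_bounded (M := 2 * y₂ ^ σ * (B X / σ)) measure_Ioc_lt_top.ne hmeas ?_
    exact (ae_restrict_iff' measurableSet_Ioc).2 (Eventually.of_forall hb)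
  have hh2 : IntegrableOn h (Ioi X) := by
    have h2 : IntegrableOn (fun t ↦ 2 * y₂ ^ (1 + σ) * (B t / t ^ 2)) (Ioi X) := hBi.const_mul _
    refine h2.congr_fun (fun u hu ↦ ?_) measurableSet_Ioi
    simp only [hh, if_neg (not_le.2 (mem_Ioi.1 hu))]
  have hhI : IntegrableOn h (Ioi 0) := by
    have := hh1.union hh2
    rwa [Ioc_union_Ioi_eq_Ioi hX.le] at this
  have hhabs : Integrable fun t : ℝ ↦ h |t| := XiKernel.integrable_comp_abs_of_integrableOn hhI
  -- measurability of `f`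
  have hfm : AEStronglyMeasurable f volume :=
    (continuous_perronKernel_vertical hy₁ hy₂0 hσ).aestronglyMeasurable.mul hGm
  have hfi : Integrable f := hhabs.mono' hfm (Eventually.of_forall hpt)
  refine ⟨hfi, ?_⟩
  -- `∫ ‖f‖ ≤ ∫ h |t| = 2 ∫_{(0,∞)} h = 2 (∫_{(0,X]} + ∫_{(X,∞)})`
  have hnonneg_h : ∀ u, 0 < u → 0 ≤ h u := by
    intro u hu
    simp only [hh]
    split_ifs
    · have := hBnn u hu.le; positivity
    · have := hBnn u hu.le; positivity
  calc ∫ t : ℝ, ‖f t‖ ≤ ∫ t : ℝ, h |t| := integral_mono hfi.norm hhabs hpt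
    _ = 2 * ∫ u in Ioi (0 : ℝ), h u := integral_comp_abs
    _ = 2 * ((∫ u in Ioc 0 X, h u) + ∫ u in Ioi X, h u) := by
        rw [← setIntegral_union (Set.disjoint_left.2 fun u hu hu' ↦ (not_lt.2 hu.2) (mem_Ioi.1 hu'))
          measurableSet_Ioi hh1 hh2, Ioc_union_Ioi_eq_Ioi hX.le]
    _ = 2 * ((∫ u in Ioc 0 X, 2 * y₂ ^ σ * (B u / (σ + u))) +
          ∫ u in Ioi X, 2 * y₂ ^ (1 + σ) * (B u / u ^ 2)) := by
        congr 2
        · exact setIntegral_congr_fun measurableSet_Ioc fun u hu ↦ by simp only [hh, if_pos hu.2]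
        · exact setIntegral_congr_fun measurableSet_Ioi fun u hu ↦ by
            simp only [hh, if_neg (not_le.2 (mem_Ioi.1 hu))]
    _ = 4 * y₂ ^ σ * (∫ t in Ioc 0 X, B t / (σ + t)) + 4 * y₂ ^ (1 + σ) * ∫ t in Ioi X, B t / t ^ 2 := by
        rw [MeasureTheory.integral_const_mul, MeasureTheory.integral_const_mul]; ring

/-! ### Moving the line of integration across the real simple poles -/

/-- **Perron inversion: shifting the contour and collecting the residues** (BDR 2023, proof of Theorem 3.2,
(3.7)–(3.8): "We transfer the integration contour … which is justified in view of the bound (3.4). By the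
residue theorem we get `∫_x^{x+1} N_𝒫 = a(x + 1/2) + [Σ_ω …]_x^{x+1} + (1/2πi)∫_Γ …`"; BV 2024, proof of
Theorem 3.1; here for a straight contour `Re s = σ₁` and finitely many REAL simple poles). Let
`0 ≤ σ₀ < σ₁ < κ`, `1 ≤ y₁ ≤ y₂`, `H` holomorphic on `Re s > σ₀`, `S ⊂ (σ₁, κ)` finite with residues `r`, and
`G = Σ_{p∈S} r_p/(s−p) + H`. Assume `t ↦ K G(κ+it)` and `t ↦ K G(σ₁+it)` are integrable, and
`‖G(u+iT)‖ ≤ B(|T|)` for `u ∈ [σ₁, κ]`, `|T| ≥ T₁`, with `B(T)/T² → 0`. Then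
`∫ K G(κ+it) dt = 2π Σ_{p∈S} r_p K(y₁,y₂;p) + ∫ K G(σ₁+it) dt`.
[cite: BrouckeDebruyneRevesz2023, proof of Theorem 3.2, (3.7)–(3.8)] -/
theorem perron_integral_eq_residues_add {H : ℂ → ℂ} {B : ℝ → ℝ} {σ₀ σ₁ κ y₁ y₂ T₁ : ℝ} (S : Finset ℝ)
    (r : ℝ → ℂ) (hσ₀ : 0 ≤ σ₀) (hσ₀₁ : σ₀ < σ₁) (hσ₁κ : σ₁ < κ) (hy₁ : 1 ≤ y₁) (hy₁₂ : y₁ ≤ y₂)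
    (hS : ∀ p ∈ S, σ₁ < p ∧ p < κ) (hH : DifferentiableOn ℂ H {s : ℂ | σ₀ < s.re})
    (hintκ : Integrable fun t : ℝ ↦
      perronKernel y₁ y₂ ((κ : ℂ) + t * I) * (polePart S r ((κ : ℂ) + t * I) + H ((κ : ℂ) + t * I)))
    (hintσ : Integrable fun t : ℝ ↦
      perronKernel y₁ y₂ ((σ₁ : ℂ) + t * I) * (polePart S r ((σ₁ : ℂ) + t * I) + H ((σ₁ : ℂ) + t * I)))
    (hbound : ∀ T : ℝ, T₁ ≤ |T| → ∀ u ∈ Icc σ₁ κ, ‖polePart S r ((u : ℂ) + T * I) + H ((u : ℂ) + T * I)‖ ≤ B |T|)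
    (hB : Tendsto (fun T : ℝ ↦ B T / T ^ 2) atTop (𝓝 0)) :
    ∫ t : ℝ, perronKernel y₁ y₂ ((κ : ℂ) + t * I) * (polePart S r ((κ : ℂ) + t * I) + H ((κ : ℂ) + t * I)) =
      2 * π * ∑ p ∈ S, r p * perronKernel y₁ y₂ p +
        ∫ t : ℝ, perronKernel y₁ y₂ ((σ₁ : ℂ) + t * I) *
          (polePart S r ((σ₁ : ℂ) + t * I) + H ((σ₁ : ℂ) + t * I)) := by
  classical
  have hy₁0 : 0 < y₁ := by linarith
  have hy₂0 : 0 < y₂ := by linarith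
  have hy₂1 : 1 ≤ y₂ := hy₁.trans hy₁₂
  -- the integrand and the open set
  set F : ℂ → ℂ := fun s ↦ perronKernel y₁ y₂ s * (polePart S r s + H s) with hF
  set U : Set ℂ := {s : ℂ | σ₀ < s.re} with hU
  have hUo : IsOpen U := isOpen_lt continuous_const Complex.continuous_re
  set S' : Finset ℂ := S.image (fun p : ℝ ↦ (p : ℂ)) with hS'
  have hmemS' : ∀ {z : ℂ}, z ∈ S' ↔ ∃ p ∈ S, (p : ℂ) = z := by
    intro z; simp [hS']
  -- differentiability of the pieces
  have hKd : ∀ {z : ℂ}, z ∈ U → DifferentiableAt ℂ (perronKernel y₁ y₂) z := fun hz ↦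
    differentiableAt_perronKernel hy₁0 hy₂0 (lt_of_le_of_lt hσ₀ hz)
  have hinvd : ∀ (q : ℝ) {z : ℂ}, z ≠ (q : ℂ) → DifferentiableAt ℂ (fun w ↦ r q / (w - q)) z :=
    fun q z hz ↦ (differentiableAt_const _).div (differentiableAt_id.sub_const _) (sub_ne_zero.2 hz)
  have hHd : ∀ {z : ℂ}, z ∈ U → DifferentiableAt ℂ H z := fun hz ↦
    hH.differentiableAt (hUo.mem_nhds hz)
  -- `F` is differentiable on `U \ S'`
  have hFd : DifferentiableOn ℂ F (U \ ↑S') := by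
    intro z hz
    have hzq : ∀ q ∈ S, z ≠ (q : ℂ) := fun q hq h ↦ hz.2 (by
      rw [Finset.mem_coe, hmemS']; exact ⟨q, hq, h.symm⟩)
    refine DifferentiableAt.differentiableWithinAt ?_
    refine (hKd hz.1).mul (DifferentiableAt.add ?_ (hHd hz.1))
    show DifferentiableAt ℂ (fun w ↦ ∑ p ∈ S, r p / (w - p)) z
    exact DifferentiableAt.fun_sum fun q hq ↦ hinvd q (hzq q hq)
  -- the simple-pole structure at each `p ∈ S`
  have hpole : ∀ p' ∈ S', ∃ φ : ℂ → ℂ, ∃ V ∈ 𝓝 p', DifferentiableOn ℂ φ V ∧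
      φ p' = (fun z : ℂ ↦ r z.re * perronKernel y₁ y₂ z) p' ∧
      ∀ z ∈ V, z ≠ p' → F z = φ z / (z - p') := by
    intro p' hp'
    obtain ⟨p, hp, rfl⟩ := hmemS'.1 hp'
    have hpU : (p : ℂ) ∈ U := by
      show σ₀ < (p : ℂ).re
      simp only [ofReal_re]; linarith [(hS p hp).1]
    -- the neighbourhood: inside `U`, away from the other poles
    set V : Set ℂ := U ∩ ⋂ q ∈ S.erase p, {z : ℂ | z ≠ (q : ℂ)} with hV
    have hVo : IsOpen V := hUo.inter (isOpen_biInter_finset fun q _ ↦ isOpen_ne)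
    have hpV : (p : ℂ) ∈ V := by
      refine ⟨hpU, ?_⟩
      simp only [mem_iInter, mem_setOf_eq]
      intro q hq h
      exact (Finset.mem_erase.1 hq).1 (by exact_mod_cast h.symm)
    set φ : ℂ → ℂ := fun z ↦ perronKernel y₁ y₂ z *
      (r p + (z - p) * (∑ q ∈ S.erase p, r q / (z - q) + H z)) with hφ
    refine ⟨φ, V, hVo.mem_nhds hpV, ?_, ?_, ?_⟩
    · intro z hz
      have hzU : z ∈ U := hz.1
      have hzq : ∀ q ∈ S.erase p, z ≠ (q : ℂ) := by
        have := hz.2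
        simp only [mem_iInter, mem_setOf_eq] at this
        exact this
      refine DifferentiableAt.differentiableWithinAt ?_
      refine (hKd hzU).mul ((differentiableAt_const _).add ((differentiableAt_id.sub_const _).mul
        (DifferentiableAt.add ?_ (hHd hzU))))
      exact DifferentiableAt.fun_sum fun q hq ↦ hinvd q (hzq q hq)
    · simp [hφ]
      ring
    · intro z hz hzp
      have hzp' : z - p ≠ 0 := sub_ne_zero.2 hzp
      simp only [hF, hφ, polePart]
      rw [← Finset.add_sum_erase S (fun q ↦ r q / (z - q)) hp]
      field_simp
      ring
  -- the residue theorem on `[σ₁, κ] × [−T, T]`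
  have hrect : ∀ T : ℝ, 0 < T →
      rectBoundaryIntegral F σ₁ κ (-T) T = 2 * π * I * ∑ p ∈ S, r p * perronKernel y₁ y₂ p := by
    intro T hT
    have hsub : ((S' : Set ℂ) ⊆ Ioo σ₁ κ ×ℂ Ioo (-T) T) := by
      intro z hz
      rw [Finset.mem_coe, hmemS'] at hz
      obtain ⟨p, hp, rfl⟩ := hz
      refine ⟨?_, ?_⟩
      · simpa using hS p hp
      · simp [hT]
    have hKU : Icc σ₁ κ ×ℂ Icc (-T) T ⊆ U := fun z hz ↦ lt_of_lt_of_le hσ₀₁ hz.1.1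
    have h := rectBoundaryIntegral_eq_sum_of_simplePoles hσ₁κ (by linarith : -T < T) S' F
      (fun z : ℂ ↦ r z.re * perronKernel y₁ y₂ z) U hUo hKU hsub hFd hpole
    rw [h, Finset.sum_image fun p _ q _ hpq ↦ by exact_mod_cast hpq]
    simp
  -- horizontal decay
  have hdecay : ∀ T : ℝ, max T₁ 1 ≤ |T| → ∀ u ∈ Icc σ₁ κ,
      ‖F ((u : ℂ) + T * I)‖ ≤ 2 * y₂ ^ (1 + κ) * (B |T| / |T| ^ 2) := by
    intro T hT u hu
    have hu0 : 0 < u := lt_of_le_of_lt hσ₀ (lt_of_lt_of_le hσ₀₁ hu.1)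
    have hT1 : 1 ≤ |T| := le_trans (le_max_right _ _) hT
    have hGb := hbound T (le_trans (le_max_left _ _) hT) u hu
    have hBT : 0 ≤ B |T| := le_trans (norm_nonneg _) hGb
    have hK := norm_perronKernel_le_two_mul hy₁0 hy₁₂ hu0 T
    have hden : |T| ^ 2 ≤ ‖((u : ℂ) + T * I) * ((u : ℂ) + T * I + 1)‖ := by
      rw [sq_abs]; exact sq_le_norm_kernelDen hu0.le T
    have hT2 : 0 < |T| ^ 2 := by positivity
    have hpow : y₂ ^ (1 + u) ≤ y₂ ^ (1 + κ) := Real.rpow_le_rpow_of_exponent_le hy₂1 (by linarith [hu.2])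
    have hK' : ‖perronKernel y₁ y₂ ((u : ℂ) + T * I)‖ ≤ 2 * y₂ ^ (1 + κ) / |T| ^ 2 := by
      refine hK.trans ?_
      calc 2 * y₂ ^ (1 + u) / ‖((u : ℂ) + T * I) * ((u : ℂ) + T * I + 1)‖
          ≤ 2 * y₂ ^ (1 + u) / |T| ^ 2 := div_le_div_of_nonneg_left (by positivity) hT2 hden
        _ ≤ 2 * y₂ ^ (1 + κ) / |T| ^ 2 := by gcongr
    simp only [hF, norm_mul]
    calc ‖perronKernel y₁ y₂ ((u : ℂ) + T * I)‖ * ‖polePart S r ((u : ℂ) + T * I) + H ((u : ℂ) + T * I)‖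
        ≤ 2 * y₂ ^ (1 + κ) / |T| ^ 2 * B |T| := mul_le_mul hK' hGb (norm_nonneg _) (by positivity)
      _ = 2 * y₂ ^ (1 + κ) * (B |T| / |T| ^ 2) := by ring
  have hg : Tendsto (fun T : ℝ ↦ 2 * y₂ ^ (1 + κ) * (B T / T ^ 2)) atTop (𝓝 0) := by
    simpa using hB.const_mul (2 * y₂ ^ (1 + κ))
  obtain ⟨htop, hbot⟩ := DMV.tendsto_horizontal_of_bound (Φ := F) hσ₁κ.le
    (g := fun T ↦ 2 * y₂ ^ (1 + κ) * (B T / T ^ 2)) (T₀ := max T₁ 1) hdecay hg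
  -- the vertical sides converge to the line integrals
  have hright : Tendsto (fun T : ℝ ↦ ∫ y in (-T)..T, F ((κ : ℂ) + y * I)) atTop
      (𝓝 (∫ y : ℝ, F ((κ : ℂ) + y * I))) :=
    intervalIntegral_tendsto_integral hintκ tendsto_neg_atTop_atBot tendsto_id
  have hleft : Tendsto (fun T : ℝ ↦ ∫ y in (-T)..T, F ((σ₁ : ℂ) + y * I)) atTop
      (𝓝 (∫ y : ℝ, F ((σ₁ : ℂ) + y * I))) :=
    intervalIntegral_tendsto_integral hintσ tendsto_neg_atTop_atBot tendsto_id
  -- pass to the limit in the rectangle identity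
  have hlim0 := ((hbot.sub htop).add (hright.const_mul I)).sub (hleft.const_mul I)
  have hlim : Tendsto (fun T : ℝ ↦ rectBoundaryIntegral F σ₁ κ (-T) T) atTop
      (𝓝 (0 - 0 + I * (∫ y : ℝ, F ((κ : ℂ) + y * I)) - I * (∫ y : ℝ, F ((σ₁ : ℂ) + y * I)))) := by
    refine hlim0.congr' (Eventually.of_forall fun T ↦ ?_)
    simp only [rectBoundaryIntegral_def, ofReal_neg, neg_mul]
  have hconst : Tendsto (fun T : ℝ ↦ rectBoundaryIntegral F σ₁ κ (-T) T) atTop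
      (𝓝 (2 * π * I * ∑ p ∈ S, r p * perronKernel y₁ y₂ p)) := by
    refine tendsto_const_nhds.congr' ?_
    filter_upwards [eventually_gt_atTop (0 : ℝ)] with T hT
    exact (hrect T hT).symm
  have heq := tendsto_nhds_unique hlim hconst
  simp only [zero_sub, neg_zero, zero_add] at heq
  have hI : I ≠ 0 := I_ne_zero
  have : (∫ y : ℝ, F ((κ : ℂ) + y * I)) - (∫ y : ℝ, F ((σ₁ : ℂ) + y * I)) =
      2 * π * ∑ p ∈ S, r p * perronKernel y₁ y₂ p := by
    apply mul_left_cancel₀ hI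
    linear_combination heq
  simp only [hF] at this
  linear_combination this

end Literature.NumberTheory.BeurlingPrimes
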